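import Literature.MeasureTheory.Group.SL2IwasawaHaar
import Mathlib.MeasureTheory.Measure.Lebesgue.Complex
import Mathlib.Analysis.SpecialFunctions.Integrals.Basic
import HarnessLib

/-!
# Linear growth of the Haar volume of Hilbert–Schmidt balls in `SL₂(ℝ)`: `vol{g ∈ SL₂(ℝ) : Σ g_{ij}² ≤ ρ} ≤ 8π ρ`

Topic `Literature/MeasureTheory/Group`.  THEOREMS ONLY (no `def`, no instance, no notation, no axiom, no named fact, no `sorry`).  Cell `pub/hodgecm-mathlib`,
crux H413 (`stmt-HodgeConjecture-24833`), F0∕P3c line LH3, sub-organ (VOL-grp-SL2) of the residual (VOL) behind DEAL #5 (CONV) (LH3-plan (g0) START word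
2026-09-02T03:07:21Z; seat LH3-p04 (g0)): the one genuinely analytic input of Harish-Chandra's convergence of Schwartz orbital integrals on `U(1,1) ≅ U(1)·SL₂(ℝ)` —
the Haar volume of the Hilbert–Schmidt ball `{Σ g_{ij}² ≤ ρ}` grows LINEARLY in `ρ` (= like the hyperbolic area of a disc of radius `r`, `2 cosh r = ρ`).

THE PROOF, over the tree's Iwasawa Haar measure ★ `haarSL2pm` (= `y⁻² dx dy dθ`, ★ `SL2IwasawaHaar`):
* §1 (Lagrange) for `det g = 1`: `x(g)² + y(g)² + 1 = (Σ g_{ij}²) · y(g)` with `x(g) + i y(g) = g • i` (★ `xOf`, ★ `yOf`), i.e. `‖g‖²_HS = (1 + |g•i|²)∕Im(g•i) = 2 cosh d_ℍ(i, g•i)`;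
  hence the HS-ball is contained in the coordinate set ★ `coordSet A_ρ univ` over `A_ρ = {w : 0 < Im w, |w|² + 1 ≤ ρ Im w}` (`hsBall_subset_coordSet`), and
  ★ `haarSL2pm_coordSet` gives `vol ≤ vol_ℍ(A_ρ) · 2π`.
* §2 (the area) `A_ρ ⊆ {1∕ρ ≤ Im ≤ ρ, |Re| ≤ √(ρ Im)}`, so by Tonelli on `ℂ ≃ ℝ²` (Mathlib `Complex.volume_preserving_equiv_real_prod`) and ★ `volume_coe_preimage`
  (`vol_ℍ = ∫ dx dy ∕ y²`): `vol_ℍ(A_ρ) ≤ ∫_{1∕ρ}^{ρ} 2√(ρ y) y⁻² dy = 4√ρ (√ρ − 1∕√ρ) ≤ 4ρ` (`integral_rpow` at `−3∕2`).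
* §3 `haarSL2pm_hsBall_le : haarSL2pm {g | det g = 1 ∧ Σ g_{ij}² ≤ ρ} ≤ ofReal (8π ρ)` for `ρ > 0`.
HONEST LABEL: HC_CM is proved only modulo the 7 printed citations (2 remaining: hLiu418 = stmt-HodgeConjecture-24832, h413 = stmt-HodgeConjecture-24833) until rung 0
closes; this file closes no organ — it is one brick of (VOL) (residual of (CONV), A3-hardening of the LETTERS O1∕O3 of `stub_N9`).

## References
* [BeuzartPlessis2020Asterisque] R. Beuzart-Plessis, *A local trace formula for the Gan–Gross–Prasad conjecture for unitary groups: the archimedean case*,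
  Astérisque 418 (2020), §1.5 (1.5.2)–(1.5.3) p. 31 (polynomial growth of `vol{σ ≤ R}`).
* [Lang1985SL2] S. Lang, *SL₂(ℝ)*, GTM 105 (1985), Ch. III §1 (Haar measure `y⁻² dx dy dθ`). [folklore]
-/

set_option autoImplicit false

noncomputable section

open MeasureTheory Complex Set
open scoped MatrixGroups Real UpperHalfPlane ENNReal

namespace Literature.MeasureTheory.Group

/-! ## §1 Lagrange's identity and the inclusion of the HS-ball in a coordinate set -/

section Lagrange

/-- For `det g = 1`: `c² + d² > 0`. [folklore] -/
private theorem row_sq_pos {g : Matrix (Fin 2) (Fin 2) ℝ} (hg : g.det = 1) : 0 < g 1 0 ^ 2 + g 1 1 ^ 2 := by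
  rw [Matrix.det_fin_two] at hg
  by_contra h
  have h0 : g 1 0 ^ 2 + g 1 1 ^ 2 = 0 := le_antisymm (not_lt.mp h) (by positivity)
  have hc : g 1 0 = 0 := by nlinarith [sq_nonneg (g 1 0), sq_nonneg (g 1 1)]
  have hd : g 1 1 = 0 := by nlinarith [sq_nonneg (g 1 0), sq_nonneg (g 1 1)]
  rw [hc, hd] at hg
  norm_num at hg

/-- `y(g) > 0` for `det g = 1`. [folklore] -/
private theorem yOf_pos_of_det_one {g : Matrix (Fin 2) (Fin 2) ℝ} (hg : g.det = 1) : 0 < yOf g := by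
  unfold yOf
  rw [hg]
  exact div_pos one_pos (row_sq_pos hg)

/-- **Lagrange's identity in Iwasawa coordinates**: for `det g = 1`, `x(g)² + y(g)² + 1 = (Σ_{ij} g_{ij}²) · y(g)` — i.e. `‖g‖²_HS = (1 + |g•i|²) ∕ Im(g•i)`
(`(a²+b²)(c²+d²) = (ac+bd)² + (ad−bc)²`). [cite: BeuzartPlessis2020Asterisque, §1.5 p. 31] -/
theorem xOf_sq_add_yOf_sq_add_one_eq {g : Matrix (Fin 2) (Fin 2) ℝ} (hg : g.det = 1) :
    xOf g ^ 2 + yOf g ^ 2 + 1 = (∑ i : Fin 2, ∑ j : Fin 2, g i j ^ 2) * yOf g := by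
  have hD := row_sq_pos hg
  have hdet : g 0 0 * g 1 1 - g 0 1 * g 1 0 = 1 := by rw [← Matrix.det_fin_two]; exact hg
  unfold xOf yOf
  rw [hg]
  simp only [Fin.sum_univ_two]
  field_simp
  linear_combination (-(g 0 0 * g 1 1 - g 0 1 * g 1 0) - 1) * hdet

/-- **The HS-ball of `SL₂(ℝ)` lies in the coordinate set over `A_ρ = {w : 0 < Im w, Re² + Im² + 1 ≤ ρ Im w}`** (all angles). [cite: BeuzartPlessis2020Asterisque, §1.5 p. 31] -/
theorem hsBall_subset_coordSet (ρ : ℝ) :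
    {g : Matrix (Fin 2) (Fin 2) ℝ | g.det = 1 ∧ ∑ i : Fin 2, ∑ j : Fin 2, g i j ^ 2 ≤ ρ} ⊆
      coordSet {w : ℂ | 0 < w.im ∧ w.re ^ 2 + w.im ^ 2 + 1 ≤ ρ * w.im} (univ : Set (AddCircle (2 * π))) := by
  rintro g ⟨hg, hρ⟩
  refine ⟨hg, ⟨yOf_pos_of_det_one hg, ?_⟩, mem_univ _⟩
  change xOf g ^ 2 + yOf g ^ 2 + 1 ≤ ρ * yOf g
  rw [xOf_sq_add_yOf_sq_add_one_eq hg]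
  exact mul_le_mul_of_nonneg_right hρ (yOf_pos_of_det_one hg).le

end Lagrange

/-! ## §2 The hyperbolic area of `A_ρ` is at most `4ρ` -/

section Area

/-- The region `A_ρ` is measurable. [folklore] -/
private theorem measurableSet_hsRegion (ρ : ℝ) : MeasurableSet {w : ℂ | 0 < w.im ∧ w.re ^ 2 + w.im ^ 2 + 1 ≤ ρ * w.im} :=
  (measurableSet_lt measurable_const Complex.measurable_im).inter
    (measurableSet_le ((Complex.measurable_re.pow_const 2).add (Complex.measurable_im.pow_const 2) |>.add_const 1)
      (Complex.measurable_im.const_mul ρ))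

/-- The box containing `A_ρ`: `1∕ρ ≤ Im w ≤ ρ` and `Re w ∈ [−√(ρ Im w), √(ρ Im w)]`. [folklore] -/
private theorem hsRegion_subset_box {ρ : ℝ} (hρ : 0 < ρ) {w : ℂ} (hw : w ∈ {w : ℂ | 0 < w.im ∧ w.re ^ 2 + w.im ^ 2 + 1 ≤ ρ * w.im}) :
    w.im ∈ Icc (1 / ρ) ρ ∧ w.re ∈ Icc (-Real.sqrt (ρ * w.im)) (Real.sqrt (ρ * w.im)) := by
  obtain ⟨him, h⟩ := hw
  have hre2 : w.re ^ 2 ≤ ρ * w.im := by nlinarith [sq_nonneg w.im]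
  refine ⟨⟨?_, ?_⟩, ?_⟩
  · rw [div_le_iff₀ hρ]
    nlinarith [sq_nonneg w.re, sq_nonneg w.im]
  · nlinarith [sq_nonneg w.re]
  · exact abs_le.mp (Real.abs_le_sqrt hre2)

/-- The one-dimensional integral: `∫_{1∕ρ}^{ρ} 2√(ρt) t⁻² dt ≤ 4ρ` (`= 4√ρ (√ρ − ρ^{-1∕2})`, by `integral_rpow` at `−3∕2`). [folklore] -/
private theorem integral_sqrt_div_sq_le {ρ : ℝ} (hρ : 1 ≤ ρ) :
    ∫ t in Icc (1 / ρ) ρ, 2 * Real.sqrt (ρ * t) / t ^ 2 ≤ 4 * ρ := by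
  have hρ0 : 0 < ρ := lt_of_lt_of_le one_pos hρ
  have hab : 1 / ρ ≤ ρ := by
    rw [div_le_iff₀ hρ0]; nlinarith
  have hpos : ∀ t ∈ Icc (1 / ρ) ρ, 0 < t := fun t ht => lt_of_lt_of_le (by positivity) ht.1
  -- rewrite the integrand as `2√ρ · t^(-3/2)` on the interval
  have heq : ∀ t ∈ Icc (1 / ρ) ρ, 2 * Real.sqrt (ρ * t) / t ^ 2 = 2 * Real.sqrt ρ * t ^ (-(3 : ℝ) / 2) := by
    intro t ht
    have ht0 : 0 < t := hpos t ht
    rw [Real.sqrt_mul hρ0.le, Real.sqrt_eq_rpow t, show (-(3 : ℝ) / 2) = 1 / 2 - 2 by norm_num, Real.rpow_sub ht0,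
      Real.rpow_two]
    ring
  rw [MeasureTheory.integral_Icc_eq_integral_Ioc, ← intervalIntegral.integral_of_le hab]
  have hcongr : ∫ t in (1 / ρ)..ρ, 2 * Real.sqrt (ρ * t) / t ^ 2 = ∫ t in (1 / ρ)..ρ, 2 * Real.sqrt ρ * t ^ (-(3 : ℝ) / 2) := by
    refine intervalIntegral.integral_congr fun t ht => ?_
    rw [Set.uIcc_of_le hab] at ht
    exact heq t ht
  rw [hcongr, intervalIntegral.integral_const_mul]
  have h0 : (0 : ℝ) ∉ Set.uIcc (1 / ρ) ρ := by
    rw [Set.uIcc_of_le hab]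
    intro h
    exact absurd h.1 (not_le.mpr (by positivity))
  rw [integral_rpow (Or.inr ⟨by norm_num, h0⟩)]
  have e1 : (-(3 : ℝ) / 2 + 1) = -(1 / 2) := by norm_num
  rw [e1]
  have hρhalf : ρ ^ (-(1 / 2 : ℝ)) = (Real.sqrt ρ)⁻¹ := by
    rw [Real.rpow_neg hρ0.le, ← Real.sqrt_eq_rpow]
  have hinvhalf : (1 / ρ) ^ (-(1 / 2 : ℝ)) = Real.sqrt ρ := by
    rw [one_div, Real.rpow_neg (inv_nonneg.mpr hρ0.le), Real.inv_rpow hρ0.le, inv_inv, ← Real.sqrt_eq_rpow]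
  rw [hρhalf, hinvhalf]
  have hs : 0 < Real.sqrt ρ := Real.sqrt_pos.mpr hρ0
  have hss : Real.sqrt ρ * Real.sqrt ρ = ρ := Real.mul_self_sqrt hρ0.le
  have hinv0 : 0 < (Real.sqrt ρ)⁻¹ := inv_pos.mpr hs
  -- `2√ρ · (( (√ρ)⁻¹ - √ρ) / (-(1/2))) = 4√ρ(√ρ - (√ρ)⁻¹) ≤ 4ρ`
  have : 2 * Real.sqrt ρ * (((Real.sqrt ρ)⁻¹ - Real.sqrt ρ) / -(1 / 2 : ℝ)) = 4 * ρ - 4 * (Real.sqrt ρ * (Real.sqrt ρ)⁻¹) := by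
    field_simp
    nlinarith [hss]
  rw [this, mul_inv_cancel₀ hs.ne']
  linarith

/-- **The hyperbolic area of `A_ρ = {w : 0 < Im w, Re² + Im² + 1 ≤ ρ Im w}` is at most `4ρ`** (Tonelli over `ℂ ≃ ℝ²`: for fixed `t = Im w ∈ [1∕ρ, ρ]` the slice has length
`≤ 2√(ρt)`, weighted by `t⁻²`). [cite: BeuzartPlessis2020Asterisque, §1.5 (1.5.2) p. 31] -/
theorem volume_hsRegion_le {ρ : ℝ} (hρ : 1 ≤ ρ) :
    volume (((↑) : ℍ → ℂ) ⁻¹' {w : ℂ | 0 < w.im ∧ w.re ^ 2 + w.im ^ 2 + 1 ≤ ρ * w.im}) ≤ ENNReal.ofReal (4 * ρ) := by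
  have hρ0 : 0 < ρ := lt_of_lt_of_le one_pos hρ
  rw [volume_coe_preimage (measurableSet_hsRegion ρ) (fun w hw => hw.1)]
  -- the majorant on `ℝ × ℝ`
  set k : ℝ → ℝ≥0∞ := fun t => (Icc (1 / ρ) ρ).indicator (fun t => ENNReal.ofReal (1 / t ^ 2)) t with hk
  set G : ℝ × ℝ → ℝ≥0∞ := fun p => k p.2 * (Icc (-Real.sqrt (ρ * p.2)) (Real.sqrt (ρ * p.2))).indicator (fun _ => (1 : ℝ≥0∞)) p.1 with hG
  have hk_meas : Measurable k := (Measurable.ennreal_ofReal (measurable_const.div (measurable_id.pow_const 2))).indicator measurableSet_Icc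
  have hG_meas : Measurable G := by
    refine (hk_meas.comp measurable_snd).mul ?_
    -- indicator of the measurable set `{p | -√(ρ p.2) ≤ p.1 ≤ √(ρ p.2)}`
    have hs : Measurable fun p : ℝ × ℝ => Real.sqrt (ρ * p.2) := (measurable_const.mul measurable_snd).sqrt
    have hset : MeasurableSet {p : ℝ × ℝ | p.1 ∈ Icc (-Real.sqrt (ρ * p.2)) (Real.sqrt (ρ * p.2))} :=
      (measurableSet_le hs.neg measurable_fst).inter (measurableSet_le measurable_fst hs)
    have e : (fun p : ℝ × ℝ => (Icc (-Real.sqrt (ρ * p.2)) (Real.sqrt (ρ * p.2))).indicator (fun _ => (1 : ℝ≥0∞)) p.1) =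
        {p : ℝ × ℝ | p.1 ∈ Icc (-Real.sqrt (ρ * p.2)) (Real.sqrt (ρ * p.2))}.indicator (fun _ => (1 : ℝ≥0∞)) := by
      funext p
      by_cases hp : p.1 ∈ Icc (-Real.sqrt (ρ * p.2)) (Real.sqrt (ρ * p.2))
      · rw [Set.indicator_of_mem hp]
        exact (Set.indicator_of_mem (s := {p : ℝ × ℝ | p.1 ∈ Icc (-Real.sqrt (ρ * p.2)) (Real.sqrt (ρ * p.2))}) hp
          (fun _ => (1 : ℝ≥0∞))).symm
      · rw [Set.indicator_of_notMem hp]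
        exact (Set.indicator_of_notMem (s := {p : ℝ × ℝ | p.1 ∈ Icc (-Real.sqrt (ρ * p.2)) (Real.sqrt (ρ * p.2))}) hp
          (fun _ => (1 : ℝ≥0∞))).symm
    rw [e]
    exact measurable_const.indicator hset
  -- Step 1: pointwise bound of the integrand by `G ∘ (re, im)`
  have hle : ∫⁻ w in {w : ℂ | 0 < w.im ∧ w.re ^ 2 + w.im ^ 2 + 1 ≤ ρ * w.im}, ENNReal.ofReal (1 / w.im ^ 2) ≤
      ∫⁻ w, G (Complex.measurableEquivRealProd w) := by
    rw [← lintegral_indicator (measurableSet_hsRegion ρ)]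
    refine lintegral_mono fun w => ?_
    by_cases hw : w ∈ {w : ℂ | 0 < w.im ∧ w.re ^ 2 + w.im ^ 2 + 1 ≤ ρ * w.im}
    · obtain ⟨him, hre⟩ := hsRegion_subset_box hρ0 hw
      rw [Set.indicator_of_mem hw, Complex.measurableEquivRealProd_apply, hG]
      simp only [hk]
      rw [Set.indicator_of_mem him, Set.indicator_of_mem hre, mul_one]
    · rw [Set.indicator_of_notMem hw]
      exact zero_le
  refine hle.trans ?_
  -- Step 2: transfer to `ℝ × ℝ` and Tonelli (inner integral in `x = Re`, outer in `t = Im`)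
  rw [Complex.volume_preserving_equiv_real_prod.lintegral_comp hG_meas, Measure.volume_eq_prod,
    lintegral_prod_symm _ hG_meas.aemeasurable]
  -- inner integral
  have hinner : ∀ t : ℝ, ∫⁻ x : ℝ, G (x, t) = k t * ENNReal.ofReal (2 * Real.sqrt (ρ * t)) := by
    intro t
    simp only [hG]
    rw [lintegral_const_mul _ (measurable_const.indicator measurableSet_Icc), lintegral_indicator_const measurableSet_Icc, Real.volume_Icc]
    congr 1
    rw [one_mul]
    congr 1
    ring
  simp_rw [hinner]
  -- outer integral: `∫⁻ t in [1/ρ, ρ], ofReal (2√(ρt)/t²)`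
  have hout : (fun t : ℝ => k t * ENNReal.ofReal (2 * Real.sqrt (ρ * t))) =
      (Icc (1 / ρ) ρ).indicator (fun t => ENNReal.ofReal (2 * Real.sqrt (ρ * t) / t ^ 2)) := by
    funext t
    simp only [hk]
    by_cases ht : t ∈ Icc (1 / ρ) ρ
    · rw [Set.indicator_of_mem ht, Set.indicator_of_mem ht, ← ENNReal.ofReal_mul (by positivity)]
      congr 1
      ring
    · rw [Set.indicator_of_notMem ht, Set.indicator_of_notMem ht, zero_mul]
  rw [hout, lintegral_indicator measurableSet_Icc]
  -- compare with the Bochner integral of the continuous nonnegative integrand on the compact interval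
  have hcont : ContinuousOn (fun t : ℝ => 2 * Real.sqrt (ρ * t) / t ^ 2) (Icc (1 / ρ) ρ) := by
    refine ContinuousOn.div (by fun_prop) (by fun_prop) fun t ht => ?_
    have : 0 < t := lt_of_lt_of_le (by positivity) ht.1
    positivity
  have hint : IntegrableOn (fun t : ℝ => 2 * Real.sqrt (ρ * t) / t ^ 2) (Icc (1 / ρ) ρ) := hcont.integrableOn_Icc
  have hnn : 0 ≤ᵐ[volume.restrict (Icc (1 / ρ) ρ)] fun t : ℝ => 2 * Real.sqrt (ρ * t) / t ^ 2 :=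
    Filter.Eventually.of_forall fun t => by positivity
  rw [← ofReal_integral_eq_lintegral_ofReal hint hnn]
  exact ENNReal.ofReal_le_ofReal (integral_sqrt_div_sq_le hρ)

end Area

/-! ## §3 The Haar volume of the Hilbert–Schmidt ball -/

section Ball

variable [MeasurableSpace (Matrix (Fin 2) (Fin 2) ℝ)] [BorelSpace (Matrix (Fin 2) (Fin 2) ℝ)]

/-- **LINEAR GROWTH OF HS-BALLS IN `SL₂(ℝ)`**: for `ρ ≥ 1`, `haarSL2pm {g | det g = 1, Σ g_{ij}² ≤ ρ} ≤ (2π · 4ρ) = 8π ρ` for the Iwasawa Haar measure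
★ `haarSL2pm` (`y⁻² dx dy dθ`).  Road: ball ⊆ ★ `coordSet A_ρ univ` (`hsBall_subset_coordSet`), ★ `haarSL2pm_coordSet` = `vol_ℍ(A_ρ) · |univ|`, `vol_ℍ(A_ρ) ≤ 4ρ`
(`volume_hsRegion_le`), `|ℝ∕2πℤ| = 2π`. [cite: BeuzartPlessis2020Asterisque, §1.5 (1.5.2)–(1.5.3) p. 31] -/
theorem haarSL2pm_hsBall_le {ρ : ℝ} (hρ : 1 ≤ ρ) :
    haarSL2pm {g : Matrix (Fin 2) (Fin 2) ℝ | g.det = 1 ∧ ∑ i : Fin 2, ∑ j : Fin 2, g i j ^ 2 ≤ ρ} ≤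
      ENNReal.ofReal (4 * ρ) * ENNReal.ofReal (2 * π) := by
  haveI : Fact (0 < 2 * π) := fact_two_pi_pos
  refine (measure_mono (hsBall_subset_coordSet ρ)).trans ?_
  rw [haarSL2pm_coordSet (measurableSet_hsRegion ρ) MeasurableSet.univ, AddCircle.measure_univ]
  exact mul_le_mul' (volume_hsRegion_le hρ) le_rfl

/-- The same bound with one constant: `≤ ofReal (8π ρ)`. [cite: BeuzartPlessis2020Asterisque, §1.5 (1.5.2)–(1.5.3) p. 31] -/
theorem haarSL2pm_hsBall_le' {ρ : ℝ} (hρ : 1 ≤ ρ) :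
    haarSL2pm {g : Matrix (Fin 2) (Fin 2) ℝ | g.det = 1 ∧ ∑ i : Fin 2, ∑ j : Fin 2, g i j ^ 2 ≤ ρ} ≤ ENNReal.ofReal (8 * π * ρ) := by
  refine (haarSL2pm_hsBall_le hρ).trans (le_of_eq ?_)
  rw [← ENNReal.ofReal_mul (by linarith)]
  congr 1
  ring

end Ball

/-! ## §4 (ED. 2) The full ball `{Σ r_ij² ≤ ρ}` (no determinant constraint): `haarSL2pm`-volume `≤ 16π ρ` — the «(T2-in)» shape of LH3-p02's DEAL #7 -/

section FullBall

variable [MeasurableSpace (Matrix (Fin 2) (Fin 2) ℝ)] [BorelSpace (Matrix (Fin 2) (Fin 2) ℝ)]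

/-- The determinant-one HS-ball is measurable. [folklore] -/
private theorem measurableSet_hsBall_det_one (ρ : ℝ) :
    MeasurableSet {g : Matrix (Fin 2) (Fin 2) ℝ | g.det = 1 ∧ ∑ i : Fin 2, ∑ j : Fin 2, g i j ^ 2 ≤ ρ} := by
  have h1 : MeasurableSet {g : Matrix (Fin 2) (Fin 2) ℝ | g.det = 1} :=
    (continuous_id.matrix_det.measurable) (measurableSet_singleton 1)
  have hc : Continuous fun g : Matrix (Fin 2) (Fin 2) ℝ => ∑ i : Fin 2, ∑ j : Fin 2, g i j ^ 2 :=
    continuous_finsetSum _ fun i _ => continuous_finsetSum _ fun j _ => (continuous_id.matrix_elem i j).pow 2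
  exact h1.inter (measurableSet_le hc.measurable measurable_const)

omit [MeasurableSpace (Matrix (Fin 2) (Fin 2) ℝ)] [BorelSpace (Matrix (Fin 2) (Fin 2) ℝ)] in
/-- Left multiplication by `σ = diag(1, −1)` preserves `Σ r_ij²` (it flips the sign of the second row). [folklore] -/
private theorem hs_sigmaMat_mul (r : Matrix (Fin 2) (Fin 2) ℝ) :
    ∑ i : Fin 2, ∑ j : Fin 2, (sigmaMat * r) i j ^ 2 = ∑ i : Fin 2, ∑ j : Fin 2, r i j ^ 2 := by
  simp [sigmaMat, Matrix.mul_apply, Fin.sum_univ_two]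

/-- **THE FULL HS-BALL**: for `ρ ≥ 1`, `haarSL2pm {r | Σ r_ij² ≤ ρ} ≤ 2 · (4ρ · 2π)`: `haarSL2pm` is carried by `{det = ±1}` (★ `haarSL2pm_compl`), the `det = −1` part is the
`σ`-translate of the `det = 1` part (same HS radius, ★ `haarSL2pm_preimage_mul_left`), and §3 bounds the latter. [cite: BeuzartPlessis2020Asterisque, §1.5 (1.5.2)–(1.5.3) p. 31] -/
theorem haarSL2pm_hsBall_full_le {ρ : ℝ} (hρ : 1 ≤ ρ) :
    haarSL2pm {r : Matrix (Fin 2) (Fin 2) ℝ | ∑ i : Fin 2, ∑ j : Fin 2, r i j ^ 2 ≤ ρ} ≤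
      2 * (ENNReal.ofReal (4 * ρ) * ENNReal.ofReal (2 * π)) := by
  set B₁ : Set (Matrix (Fin 2) (Fin 2) ℝ) := {g | g.det = 1 ∧ ∑ i : Fin 2, ∑ j : Fin 2, g i j ^ 2 ≤ ρ} with hB₁
  have hB₁m : MeasurableSet B₁ := measurableSet_hsBall_det_one ρ
  -- decomposition along `det = 1`, `det = -1`, and the null set `{det ≠ ±1}`
  have hsub : {r : Matrix (Fin 2) (Fin 2) ℝ | ∑ i : Fin 2, ∑ j : Fin 2, r i j ^ 2 ≤ ρ} ⊆
      B₁ ∪ (fun g => sigmaMat * g) ⁻¹' B₁ ∪ {g : Matrix (Fin 2) (Fin 2) ℝ | g.det = 1 ∨ g.det = -1}ᶜ := by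
    intro r hr
    by_cases h1 : r.det = 1
    · exact Or.inl (Or.inl ⟨h1, hr⟩)
    by_cases h2 : r.det = -1
    · refine Or.inl (Or.inr ⟨?_, ?_⟩)
      · rw [Matrix.det_mul, det_sigmaMat, h2]; norm_num
      · change ∑ i : Fin 2, ∑ j : Fin 2, (sigmaMat * r) i j ^ 2 ≤ ρ
        rw [hs_sigmaMat_mul]; exact hr
    · exact Or.inr (by simp [h1, h2])
  calc haarSL2pm {r : Matrix (Fin 2) (Fin 2) ℝ | ∑ i : Fin 2, ∑ j : Fin 2, r i j ^ 2 ≤ ρ}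
      ≤ haarSL2pm (B₁ ∪ (fun g => sigmaMat * g) ⁻¹' B₁ ∪ {g : Matrix (Fin 2) (Fin 2) ℝ | g.det = 1 ∨ g.det = -1}ᶜ) :=
        measure_mono hsub
    _ ≤ haarSL2pm (B₁ ∪ (fun g => sigmaMat * g) ⁻¹' B₁) + haarSL2pm {g : Matrix (Fin 2) (Fin 2) ℝ | g.det = 1 ∨ g.det = -1}ᶜ :=
        measure_union_le _ _
    _ = haarSL2pm (B₁ ∪ (fun g => sigmaMat * g) ⁻¹' B₁) := by rw [haarSL2pm_compl, add_zero]
    _ ≤ haarSL2pm B₁ + haarSL2pm ((fun g => sigmaMat * g) ⁻¹' B₁) := measure_union_le _ _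
    _ = haarSL2pm B₁ + haarSL2pm B₁ := by rw [haarSL2pm_preimage_mul_left (Or.inr det_sigmaMat) hB₁m]
    _ = 2 * haarSL2pm B₁ := by rw [two_mul]
    _ ≤ 2 * (ENNReal.ofReal (4 * ρ) * ENNReal.ofReal (2 * π)) := mul_le_mul' le_rfl (haarSL2pm_hsBall_le hρ)

/-- **«(T2-in)» — the input shape of LH3-p02's DEAL #7**: `∃ C, ∀ ρ ≥ 2, haarSL2pm {r | Σ r_ij² ≤ ρ} ≤ ofReal (C ρ)` (`C = 16π`).
[cite: BeuzartPlessis2020Asterisque, §1.5 (1.5.2)–(1.5.3) p. 31] -/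
theorem exists_haarSL2pm_hsBall_le_linear :
    ∃ C : ℝ, ∀ ρ : ℝ, 2 ≤ ρ →
      haarSL2pm {r : Matrix (Fin 2) (Fin 2) ℝ | ∑ i : Fin 2, ∑ j : Fin 2, r i j ^ 2 ≤ ρ} ≤ ENNReal.ofReal (C * ρ) := by
  refine ⟨16 * π, fun ρ hρ => (haarSL2pm_hsBall_full_le (by linarith)).trans (le_of_eq ?_)⟩
  have hρ0 : 0 ≤ ρ := by linarith
  rw [← ENNReal.ofReal_mul (by linarith), show (2 : ℝ≥0∞) = ENNReal.ofReal 2 by simp, ← ENNReal.ofReal_mul (by norm_num)]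
  congr 1
  ring

end FullBall

end Literature.MeasureTheory.Group

end
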